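import Summits.PneNP.PneNP.Theorems.ExpanderLinearGeneratorsGridRoutingOverlay

/-!
# PneNP / ExpanderLinearGenerators — the overlaid grid routing system is a boundary expander

Route `PneNP/ExpanderLinearGenerators`, support for crux stmt-PneNP-11443. For a `D₀`-regular graph
`G` on the `C` copies of the grid rows in which every vertex set `U` with `|U| ≤ s` spans at most
`(1 + 1/8)|U|` edges, the row supports of `overlaySystem k C G` form an `(r, D₀ - 41/4)`-boundary
expander for every `r ≤ s`: summing support sizes over a row set `F` counts every variable of the
cover once or twice (every variable lies in exactly two equations), the twice-counted ones being
grid variables (at most `4|F|`, the grid parts having `≤ 4` variables) or edges of `G` inside `F`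
(at most `(9/8)|F|`). With `D₀ = 56`: supports `≤ 60` and `(r, 45) = (r, 3/4 · 60)`-expansion —
the hypotheses of `LinearGeneratorDepthFregeHard` with `ℓ = 60`.

* `isBoundaryExpander_overlaySystem`.

References: E. Ben-Sasson, A. Wigderson, J. ACM 48 (2001), §5–6 (boundary expansion);
J. Krajíček, *Proof complexity* (CUP 2019), §13.3.
-/

namespace Summit.PneNP.PneNP.Theorems.GridRouting

set_option linter.dupNamespace false -- `Summit.PneNP.PneNP.…`: summit = sub-problem (D-0017)

open Finset Literature.Computability.MetaComplexity
open Literature.ModelTheory.FiniteModelTheory.ConnerydGhannanePang (edgesIn mem_edgesIn IsSparse)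

variable {k C : ℕ} {G : SimpleGraph (Fin C × Fin (nRows k))} [DecidableRel G.Adj]

/-- Unfolding the scopes. [folklore] -/
theorem oscope_eq (i : Fin (ORows k C)) :
    oscope k C G i = (overlaySystem k C G i).supp.map Fin.valEmbedding := rfl

/-- Membership in a scope, through the variable number. [folklore] -/
theorem mem_oscope_iff {i : Fin (ORows k C)} {y : Fin (OVars k C G)} :
    (y : ℕ) ∈ oscope k C G i ↔ y ∈ (overlaySystem k C G i).supp := by
  rw [oscope_eq]; exact Finset.mem_map' Fin.valEmbedding

/-- Points of the cover are numbers of variables. [folklore] -/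
theorem exists_var_of_mem_cover {F : Finset (Fin (ORows k C))} {x : ℕ}
    (hx : x ∈ cover (oscope k C G) F) : ∃ y : Fin (OVars k C G), (y : ℕ) = x := by
  obtain ⟨i, -, hxi⟩ := mem_cover.1 hx
  rw [oscope_eq] at hxi
  obtain ⟨y, -, rfl⟩ := Finset.mem_map.1 hxi
  exact ⟨y, rfl⟩

/-- Every point of the cover is covered at most twice. [folklore] -/
theorem coverDegree_le_two (hC : 0 < C) (F : Finset (Fin (ORows k C))) {x : ℕ}
    (hx : x ∈ cover (oscope k C G) F) : coverDegree (oscope k C G) F x ≤ 2 := by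
  obtain ⟨y, rfl⟩ := exists_var_of_mem_cover hx
  unfold coverDegree
  calc (F.filter fun i => (y : ℕ) ∈ oscope k C G i).card
      ≤ (Finset.univ.filter fun i => y ∈ (overlaySystem k C G i).supp).card := by
        refine Finset.card_le_card fun i hi => ?_
        rw [Finset.mem_filter] at hi ⊢
        exact ⟨Finset.mem_univ _, mem_oscope_iff.1 hi.2⟩
    _ = 2 := card_filter_mem_supp_overlay hC y

/-- **Double counting**: the support sizes over `F` add up to `|∂F|` plus twice the number of
twice-covered points. [Ben-Sasson–Wigderson 2001, §6] [folklore] -/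
theorem sum_card_oscope_eq (hC : 0 < C) (F : Finset (Fin (ORows k C))) :
    ∑ i ∈ F, (oscope k C G i).card = (boundary (oscope k C G) F).card +
      2 * ((cover (oscope k C G) F).filter fun x => coverDegree (oscope k C G) F x = 2).card := by
  rw [← sum_coverDegree]
  have h : ∀ x ∈ cover (oscope k C G) F, coverDegree (oscope k C G) F x =
      (if coverDegree (oscope k C G) F x = 1 then 1 else 0) +
        2 * (if coverDegree (oscope k C G) F x = 2 then 1 else 0) := by
    intro x hx
    have h1 := one_le_coverDegree hx
    have h2 := coverDegree_le_two hC F hx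
    interval_cases coverDegree (oscope k C G) F x <;> simp
  rw [Finset.sum_congr rfl h, Finset.sum_add_distrib, ← Finset.mul_sum, Finset.sum_boole,
    Finset.sum_boole]
  rfl

/-- The twice-covered points are grid variables or edges of `G` inside `F`: their number is at
most `4|F| + e(F)`. [folklore] -/
theorem card_twice_le (hC : 0 < C) (F : Finset (Fin (ORows k C))) :
    ((cover (oscope k C G) F).filter fun x => coverDegree (oscope k C G) F x = 2).card ≤
      4 * F.card + (edgesIn G (F.map (orowEquiv k C).symm.toEmbedding)).card := by
  set D2 := (cover (oscope k C G) F).filter fun x => coverDegree (oscope k C G) F x = 2 with hD2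
  -- split by the kind of variable
  have hsplit : D2.card = (D2.filter fun x => x < nVars k).card +
      (D2.filter fun x => ¬ x < nVars k).card := (Finset.card_filter_add_card_filter_not _).symm
  rw [hsplit]
  refine Nat.add_le_add ?_ ?_
  · -- grid variables of the cover: at most `4` per row of `F`
    let emb : Fin (nVars k) ↪ ℕ :=
      ⟨fun j => ((ovarEquiv k C G (Sum.inl j) : Fin (OVars k C G)) : ℕ), fun a b h => by
        have h' : (ovarEquiv k C G (Sum.inl a)) = ovarEquiv k C G (Sum.inl b) := Fin.ext h
        simpa using h'⟩
    let gp : Fin (ORows k C) → Finset ℕ := fun i =>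
      (Finset.univ.filter fun j : Fin (nVars k) => (((orowEquiv k C).symm i).1 : ℕ) = 0 ∧
        j ∈ (gridSystem k ((orowEquiv k C).symm i).2).supp).map emb
    have hgp : ∀ i, (gp i).card ≤ 4 := fun i => by
      simp only [gp, Finset.card_map]
      exact card_filter_gridPart_le _
    calc (D2.filter fun x => x < nVars k).card ≤ (F.biUnion gp).card := by
          refine Finset.card_le_card fun x hx => ?_
          rw [Finset.mem_filter] at hx
          obtain ⟨hxD, hxlt⟩ := hx
          rw [hD2, Finset.mem_filter] at hxD
          obtain ⟨i, hi, hxi⟩ := mem_cover.1 hxD.1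
          rw [oscope_eq] at hxi
          obtain ⟨y, hy, rfl⟩ := Finset.mem_map.1 hxi
          obtain ⟨z, rfl⟩ := (ovarEquiv k C G).surjective y
          rcases z with j | e
          · refine Finset.mem_biUnion.2 ⟨i, hi, Finset.mem_map.2 ⟨j, ?_, rfl⟩⟩
            rw [Finset.mem_filter]
            have := (mem_supp_overlay_inl (G := G) ((orowEquiv k C).symm i) j).1
              (by rw [Equiv.apply_symm_apply]; exact hy)
            exact ⟨Finset.mem_univ _, this⟩
          · exfalso
            have : ((ovarEquiv k C G (Sum.inr e) : Fin _) : ℕ) = nVars k + e := by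
              simp [ovarEquiv]
            simp only [Fin.valEmbedding_apply, this] at hxlt
            omega
      _ ≤ ∑ i ∈ F, (gp i).card := Finset.card_biUnion_le
      _ ≤ ∑ i ∈ F, 4 := Finset.sum_le_sum fun i _ => hgp i
      _ = 4 * F.card := by rw [Finset.sum_const, smul_eq_mul, mul_comm]
  · -- edge variables covered twice: edges of `G` inside `F`
    set U := F.map (orowEquiv k C).symm.toEmbedding with hU
    have hsub : (D2.filter fun x => ¬ x < nVars k) ⊆
        ((Finset.univ.filter fun e : Fin G.edgeFinset.card => edgeOf k C G e ∈ edgesIn G U).image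
          fun e => ((ovarEquiv k C G (Sum.inr e) : Fin _) : ℕ)) := by
      intro x hx
      rw [Finset.mem_filter] at hx
      obtain ⟨hxD, hxge⟩ := hx
      rw [hD2, Finset.mem_filter] at hxD
      obtain ⟨hxc, hdeg⟩ := hxD
      obtain ⟨y, rfl⟩ := exists_var_of_mem_cover hxc
      obtain ⟨z, rfl⟩ := (ovarEquiv k C G).surjective y
      rcases z with j | e
      · exfalso
        have : ((ovarEquiv k C G (Sum.inl j) : Fin _) : ℕ) = j := by simp [ovarEquiv]
        simp only [this] at hxge
        exact hxge j.2
      · refine Finset.mem_image.2 ⟨e, ?_, rfl⟩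
        rw [Finset.mem_filter]
        refine ⟨Finset.mem_univ _, ?_⟩
        -- every row containing the variable lies in `F`
        have hall : ∀ i, ovarEquiv k C G (Sum.inr e) ∈ (overlaySystem k C G i).supp → i ∈ F := by
          have heq : (F.filter fun i => ((ovarEquiv k C G (Sum.inr e) : Fin _) : ℕ) ∈ oscope k C G i) =
              Finset.univ.filter fun i => ovarEquiv k C G (Sum.inr e) ∈ (overlaySystem k C G i).supp := by
            refine Finset.eq_of_subset_of_card_le (fun i hi => ?_) ?_
            · rw [Finset.mem_filter] at hi ⊢
              exact ⟨Finset.mem_univ _, mem_oscope_iff.1 hi.2⟩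
            · rw [card_filter_mem_supp_overlay hC]
              exact hdeg.ge
          intro i hi
          have : i ∈ Finset.univ.filter fun i =>
              ovarEquiv k C G (Sum.inr e) ∈ (overlaySystem k C G i).supp :=
            Finset.mem_filter.2 ⟨Finset.mem_univ _, hi⟩
          rw [← heq, Finset.mem_filter] at this
          exact this.1
        unfold edgesIn
        rw [Finset.mem_inter, Finset.mem_sym2_iff]
        refine ⟨SimpleGraph.mem_edgeFinset.2 (edgeOf_mem e), fun a ha => ?_⟩
        have hrow := hall (orowEquiv k C a) ((mem_supp_overlay_inr a e).2 ha)
        rw [hU, Finset.mem_map]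
        exact ⟨orowEquiv k C a, hrow, by simp⟩
    calc (D2.filter fun x => ¬ x < nVars k).card
        ≤ ((Finset.univ.filter fun e : Fin G.edgeFinset.card =>
            edgeOf k C G e ∈ edgesIn G U).image
            fun e => ((ovarEquiv k C G (Sum.inr e) : Fin _) : ℕ)).card := Finset.card_le_card hsub
      _ ≤ (Finset.univ.filter fun e : Fin G.edgeFinset.card => edgeOf k C G e ∈ edgesIn G U).card :=
          Finset.card_image_le
      _ ≤ (edgesIn G U).card := by
          refine Finset.card_le_card_of_injOn (edgeOf k C G) (fun e he => ?_)
            (fun e₁ _ e₂ _ h => edgeOf_injective h)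
          rw [Finset.coe_filter] at he
          exact he.2

/-- **The overlaid grid routing system is a boundary expander.** If `G` is `D₀`-regular,
`D₀ ≥ 53`, and `(s, 1/8)`-sparse, then for every `r ≤ s` the row supports of `overlaySystem k C G`
form an `(r, 3/4 · (D₀ + 4))`-boundary expander (and have size between `D₀` and `D₀ + 4`):
`|∂F| ≥ D₀|F| - 2(4|F| + (9/8)|F|) = (D₀ - 41/4)|F| ≥ (3/4)(D₀ + 4)|F|`.
[Ben-Sasson–Wigderson 2001, §5–6; Krajíček 2019, §13.3] [folklore] -/
theorem isBoundaryExpander_overlaySystem (hC : 0 < C) {D₀ : ℕ} (hreg : G.IsRegularOfDegree D₀)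
    (hD₀ : 53 ≤ D₀) {s : ℕ} (hsparse : IsSparse G s (1 / 8)) {r : ℝ} (hr : r ≤ s) :
    IsBoundaryExpander (oscope k C G) r (3 / 4 * (D₀ + 4 : ℕ)) := by
  intro F hF
  set U := F.map (orowEquiv k C).symm.toEmbedding with hU
  have hUc : U.card = F.card := Finset.card_map _
  have hUs : U.card ≤ s := by rw [hUc]; exact_mod_cast hF.trans hr
  have hsp := hsparse U hUs
  rw [hUc] at hsp
  -- supports have size `≥ D₀`
  have hdeg : D₀ * F.card ≤ ∑ i ∈ F, (oscope k C G i).card := by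
    rw [mul_comm, ← smul_eq_mul, ← Finset.sum_const]
    refine Finset.sum_le_sum fun i _ => ?_
    rw [oscope_eq, Finset.card_map]
    have := le_card_supp_overlay (G := G) ((orowEquiv k C).symm i)
    rw [Equiv.apply_symm_apply, hreg.degree_eq] at this
    exact this
  have hmain := sum_card_oscope_eq (G := G) hC F
  have htw := card_twice_le (G := G) hC F
  rw [← hU] at htw
  have h1 : (D₀ : ℝ) * F.card ≤ (boundary (oscope k C G) F).card +
      2 * (4 * F.card + ((edgesIn G U).card : ℝ)) := by
    have : D₀ * F.card ≤ (boundary (oscope k C G) F).card + 2 * (4 * F.card + (edgesIn G U).card) := by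
      omega
    exact_mod_cast this
  have hD₀R : (53 : ℝ) ≤ D₀ := by exact_mod_cast hD₀
  have hF0 : (0 : ℝ) ≤ F.card := Nat.cast_nonneg _
  push_cast
  nlinarith [h1, hsp, hF0, hD₀R]

end Summit.PneNP.PneNP.Theorems.GridRouting
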